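import Mathlib

/-!
# The support of the unramified diagonal–diagonal orbital integral (support, seat p1)

The valuation-theoretic core of the split-place computation: over a field `F` with a valuation `v` (multiplicative,
`v x ≤ 1` = «integral», `v x = 1` = «unit»), let `γ = !![a, b; c, d]` have unit entries and unit determinant, and
let `t = diagonal (1, t₂)`, `s = diagonal (s₁, s₂)` be two diagonal elements. If `t⁻¹ γ s` is integral with unit
determinant (i.e. lies in `GL₂(O)`), then `s₁, s₂, t₂` are units (`units_of_mem_K`): the support of
`(t, s) ↦ 1_{GL₂(O)}(t⁻¹ γ s)` on the diagonal torus pair (the first torus normalised by the centre) is the single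
coset `T(O) × T(O)`. The valuation arithmetic is `valuation_units_of_integral`: with `x = v s₁`, `y = v s₂`,
`z = v t₂`, the conditions `x ≤ 1`, `y ≤ 1`, `x ≤ z`, `y ≤ z`, `x y = z` force `x = y = z = 1`.

Pure algebra over a valued field; the measure of the coset, the characters, and the adelic normalisations are not
here. Blind lane: Mathlib only; no sorry; axioms ⊆ {propext, Classical.choice, Quot.sound}.
-/

namespace Summit.Ventures.HodgeRepro2.T7SupportSplitOrbit

open Matrix

variable {F : Type*} [Field F] {Γ₀ : Type*} [LinearOrderedCommGroupWithZero Γ₀]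

/-- **the valuation arithmetic**: `x ≤ 1`, `y ≤ 1`, `x ≤ z`, `y ≤ z`, `x * y = z` with `x, y ≠ 0` force `x = y = z = 1`. -/
theorem valuation_units_of_integral {x y z : Γ₀} (hx0 : x ≠ 0) (hy0 : y ≠ 0)
    (hx : x ≤ 1) (hy : y ≤ 1) (hxz : x ≤ z) (hyz : y ≤ z) (hxyz : x * y = z) :
    x = 1 ∧ y = 1 ∧ z = 1 := by
  -- `x ≤ z = x * y` gives `1 ≤ y`; `y ≤ z = x * y` gives `1 ≤ x`
  have hy1 : 1 ≤ y := by
    have h : x⁻¹ * x ≤ x⁻¹ * (x * y) := by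
      rw [hxyz]
      gcongr
    rwa [inv_mul_cancel₀ hx0, inv_mul_cancel_left₀ hx0] at h
  have hx1 : 1 ≤ x := by
    have h : y⁻¹ * y ≤ y⁻¹ * (y * x) := by
      rw [mul_comm y x, hxyz]
      gcongr
    rwa [inv_mul_cancel₀ hy0, inv_mul_cancel_left₀ hy0] at h
  have hxe : x = 1 := le_antisymm hx hx1
  have hye : y = 1 := le_antisymm hy hy1
  refine ⟨hxe, hye, ?_⟩
  rw [← hxyz, hxe, hye, mul_one]

/-- `M` is integral for `v`: every entry has `v ≤ 1`. -/
def IsIntegral (v : Valuation F Γ₀) (M : Matrix (Fin 2) (Fin 2) F) : Prop := ∀ i j, v (M i j) ≤ 1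

/-- `M ∈ GL₂(O)`: integral with unit determinant. -/
def MemK (v : Valuation F Γ₀) (M : Matrix (Fin 2) (Fin 2) F) : Prop := IsIntegral v M ∧ v M.det = 1

/-- the entries of `diagonal (1, t₂⁻¹) * !![a, b; c, d] * diagonal (s₁, s₂)` -/
theorem conj_entries (a b c d t₂ s₁ s₂ : F) :
    diagonal ![1, t₂⁻¹] * !![a, b; c, d] * diagonal ![s₁, s₂] =
      !![a * s₁, b * s₂; c * s₁ / t₂, d * s₂ / t₂] := by
  ext i j
  rw [Matrix.mul_diagonal, Matrix.diagonal_mul]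
  fin_cases i <;> fin_cases j <;> simp [div_eq_mul_inv, mul_assoc, mul_comm, mul_left_comm]

/-- **the support is the single coset**: if `γ = !![a, b; c, d]` has unit entries and unit determinant and
`t⁻¹ γ s ∈ GL₂(O)` for `t = diagonal (1, t₂)`, `s = diagonal (s₁, s₂)` (`t₂, s₁, s₂ ≠ 0`), then `s₁, s₂, t₂` are units. -/
theorem units_of_mem_K (v : Valuation F Γ₀) (a b c d t₂ s₁ s₂ : F)
    (ha : v a = 1) (hb : v b = 1) (hc : v c = 1) (hd : v d = 1) (hdet : v (a * d - b * c) = 1)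
    (ht : t₂ ≠ 0) (hs₁ : s₁ ≠ 0) (hs₂ : s₂ ≠ 0)
    (hK : MemK v (diagonal ![1, t₂⁻¹] * !![a, b; c, d] * diagonal ![s₁, s₂])) :
    v s₁ = 1 ∧ v s₂ = 1 ∧ v t₂ = 1 := by
  obtain ⟨hint, hdet'⟩ := hK
  rw [conj_entries] at hint hdet'
  -- the four entries
  have h00 : v (a * s₁) ≤ 1 := by simpa using hint 0 0
  have h01 : v (b * s₂) ≤ 1 := by simpa using hint 0 1
  have h10 : v (c * s₁ / t₂) ≤ 1 := by simpa using hint 1 0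
  have h11 : v (d * s₂ / t₂) ≤ 1 := by simpa using hint 1 1
  rw [Matrix.det_fin_two_of] at hdet'
  have hdet2 : v (a * d - b * c) * (v s₁ * v s₂) / v t₂ = 1 := by
    have e : a * s₁ * (d * s₂ / t₂) - b * s₂ * (c * s₁ / t₂) = (a * d - b * c) * (s₁ * s₂) / t₂ := by
      field_simp
    rw [e, Valuation.map_div, Valuation.map_mul, Valuation.map_mul] at hdet'
    exact hdet'
  rw [Valuation.map_mul, ha, one_mul] at h00
  rw [Valuation.map_mul, hb, one_mul] at h01
  rw [Valuation.map_div, Valuation.map_mul, hc, one_mul] at h10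
  rw [Valuation.map_div, Valuation.map_mul, hd, one_mul] at h11
  rw [hdet, one_mul] at hdet2
  have hx0 : v s₁ ≠ 0 := (Valuation.ne_zero_iff v).2 hs₁
  have hy0 : v s₂ ≠ 0 := (Valuation.ne_zero_iff v).2 hs₂
  have hz0 : v t₂ ≠ 0 := (Valuation.ne_zero_iff v).2 ht
  have hxz : v s₁ ≤ v t₂ := by
    rwa [div_le_one₀ (lt_of_le_of_ne zero_le hz0.symm)] at h10
  have hyz : v s₂ ≤ v t₂ := by
    rwa [div_le_one₀ (lt_of_le_of_ne zero_le hz0.symm)] at h11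
  have hxyz : v s₁ * v s₂ = v t₂ := by
    rwa [div_eq_one_iff_eq hz0] at hdet2
  exact valuation_units_of_integral hx0 hy0 h00 h01 hxz hyz hxyz

end Summit.Ventures.HodgeRepro2.T7SupportSplitOrbit
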